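import Summits.QuantumFields.YangMills.Theses.SandwichVariancePinching
import Summits.QuantumFields.YangMills.Theorems.SandwichVariancePinchingSandwichMomentsLtOne

/-!
# Route `SandwichVariancePinching` — calculus of a `C²` potential under the WHITENED second-difference
# sandwich `(1−δ)|h|² ≤ A(x+h) + A(x−h) − 2A(x) ≤ (1+δ)|h|²` (toolkit for the cruxes
# `QuadraticVarianceFloor` stmt-QuantumFields-28260 and `QuadraticVarianceCeiling` stmt-QuantumFields-28259)

The two cruxes are variance pinchings for the Gibbs weight `e^{−A}` on `ℝⁿ`.  Their proofs (affine-score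
integration by parts; sibling files `…ScoreIdentities`, `…ScoreSecondMoment`) run for SMOOTH potentials and
need, pointwise and in integrated form, what the second-DIFFERENCE sandwich says about DERIVATIVES.  This
file supplies exactly that, sorry-free, for `A ∈ C²(ℝⁿ)` (`ℝⁿ = Fin n → ℝ`, sup norm, Lebesgue measure):

* §1 `fderiv_fderiv_le_of_secondDiff_le` / `le_fderiv_fderiv_of_le_secondDiff`: second differences
  `≤ K|h|²` (resp. `≥ K|h|²`) force `D²f(x)(u,u) ≤ K|u|²` (resp. `≥`) — Taylor to second order
  (`Convex.taylor_approx_two_segment`); `fderiv_fderiv_symm`; the polarisation bound `abs_bilin_le_of_diag`;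
  hence `|D²A(x)(u,w)| ≤ (1+δ)(|u|²+|w|²)/2` and, by the mean value inequality along `t ↦ t•x`, the
  quadratic growth `|∂ᵥA(x)| ≤ ‖DA(0)‖‖v‖ + (1+δ)(|x|²+|v|²)/2` (`abs_fderiv_le_of_sandwich`).
* §2 Gaussian domination for polynomial weights of degree `≤ 8` (`integrable_mul_exp_neg_of_growth`,
  extending the degree-4 lemma `integrable_mul_exp_neg_of_lower_bound` of `…SandwichMomentsLtOne`), and the
  quadratic lower bound `−C(1+‖x‖) + κ‖x‖² ≤ A(x)` from the sandwich with `δ < 1`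
  (`exists_quadratic_lower_of_sandwich`).
* §3 continuity / sup-norm growth packaging of `∂ᵥA` and `D²A` used by the integrability side conditions.

HONEST SCOPE.  Helper lemmas (free-hands work of the LEAD seat of crux stmt-QuantumFields-22884, cell
ym-idea-1) toward the SVP cruxes 28260/28259 of planner ym-idea-3's draft-by-design sub-line onto
`LogConcaveChart.QuadraticCovarianceComparison` (stmt-QuantumFields-26240); nothing here proves either crux,
that comparison, the `LogConcaveChart` thesis, rung R2a or any summit statement; the Yang–Mills mass gap is
NOT proved by any of this.
-/

noncomputable section

namespace Summit.QuantumFields.YangMills.Theorems.SandwichVariancePinching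

open MeasureTheory Real Filter Topology Asymptotics

variable {n : ℕ}

/-! ## §1 Second differences versus second derivatives -/

/-- SECOND DIFFERENCES CONTROL THE SECOND DERIVATIVE (upper): if `f ∈ C²(ℝⁿ)` and
`f(x+h) + f(x−h) − 2f(x) ≤ K·|h|²` for all `x, h`, then `D²f(x)(u,u) ≤ K·|u|²`. [folklore] -/
theorem fderiv_fderiv_le_of_secondDiff_le {f : (Fin n → ℝ) → ℝ} (hf : ContDiff ℝ 2 f) {K : ℝ}
    (h2 : ∀ x h : Fin n → ℝ, f (x + h) + f (x - h) - 2 * f x ≤ K * (h ⬝ᵥ h)) (x u : Fin n → ℝ) :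
    fderiv ℝ (fderiv ℝ f) x u u ≤ K * (u ⬝ᵥ u) := by
  have hd : ∀ y, HasFDerivAt f (fderiv ℝ f y) y := fun y =>
    (hf.differentiable (by norm_num) y).hasFDerivAt
  have hd2 : HasFDerivAt (fderiv ℝ f) (fderiv ℝ (fderiv ℝ f) x) x :=
    ((hf.fderiv_right (m := 1) (by norm_num)).differentiable (by norm_num) x).hasFDerivAt
  set f'' := fderiv ℝ (fderiv ℝ f) x with hf''
  -- Taylor along `h ↦ x + h•u` and `h ↦ x − h•u`
  have T := fun w : Fin n → ℝ =>
    (convex_univ (𝕜 := ℝ) (E := Fin n → ℝ)).taylor_approx_two_segment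
      (f := f) (f' := fderiv ℝ f) (f'' := f'') (v := 0) (w := w)
      (fun y _ => hd y) (Set.mem_univ x)
      (by rw [interior_univ]; exact hd2.hasFDerivWithinAt)
      (by rw [interior_univ]; exact Set.mem_univ _) (by rw [interior_univ]; exact Set.mem_univ _)
  have T1 := T u
  have T2 := T (-u)
  simp only [smul_zero, add_zero, map_zero, zero_apply, map_neg,
    neg_apply, neg_neg, smul_neg, smul_eq_mul, neg_zero] at T1 T2
  have S := T1.add T2
  -- `S : (fun h => f(x+hu) + f(x-hu) - 2 f x - h² f'' u u) =o h²` (after simplification)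
  by_contra hlt
  push Not at hlt
  set ε : ℝ := (f'' u u - K * (u ⬝ᵥ u)) / 2 with hε
  have hεpos : 0 < ε := by rw [hε]; linarith
  have hev := S.def hεpos
  rw [Filter.Eventually, mem_nhdsWithin] at hev
  obtain ⟨U, hUo, hU0, hU⟩ := hev
  obtain ⟨r, hrpos, hr⟩ := Metric.isOpen_iff.mp hUo 0 hU0
  set h : ℝ := r / 2 with hh
  have hhpos : 0 < h := by rw [hh]; linarith
  have hmem : h ∈ U ∩ Set.Ioi 0 := ⟨hr (by simp [hh, abs_of_pos hrpos]; linarith), hhpos⟩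
  have hb := hU hmem
  simp only [Set.mem_setOf_eq, norm_pow, Real.norm_eq_abs] at hb
  have key := h2 x (h • u)
  rw [show x - h • u = x + -(h • u) by abel] at key
  have hsq : (h • u) ⬝ᵥ (h • u) = h ^ 2 * (u ⬝ᵥ u) := by
    rw [smul_dotProduct, dotProduct_smul, smul_eq_mul, smul_eq_mul]; ring
  rw [hsq] at key
  have habs := (abs_le.mp hb).1
  have hh2 : 0 < h ^ 2 := by positivity
  -- expand the expression inside `hb`
  have : |h| ^ 2 = h ^ 2 := by rw [sq_abs]
  rw [this] at habs
  have h3 : h ^ 2 * (f'' u u - K * (u ⬝ᵥ u)) ≤ ε * h ^ 2 := by nlinarith [habs, key]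
  have h4 : f'' u u - K * (u ⬝ᵥ u) = 2 * ε := by rw [hε]; ring
  rw [h4] at h3
  nlinarith [mul_pos hεpos hh2]


/-- SECOND DIFFERENCES CONTROL THE SECOND DERIVATIVE (lower): if `f ∈ C²(ℝⁿ)` and
`K·|h|² ≤ f(x+h) + f(x−h) − 2f(x)` for all `x, h`, then `K·|u|² ≤ D²f(x)(u,u)`. [folklore] -/
theorem le_fderiv_fderiv_of_le_secondDiff {f : (Fin n → ℝ) → ℝ} (hf : ContDiff ℝ 2 f) {K : ℝ}
    (h2 : ∀ x h : Fin n → ℝ, K * (h ⬝ᵥ h) ≤ f (x + h) + f (x - h) - 2 * f x) (x u : Fin n → ℝ) :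
    K * (u ⬝ᵥ u) ≤ fderiv ℝ (fderiv ℝ f) x u u := by
  have hneg : ContDiff ℝ 2 (fun y => -f y) := hf.neg
  have h2' : ∀ x h : Fin n → ℝ, (fun y => -f y) (x + h) + (fun y => -f y) (x - h)
      - 2 * (fun y => -f y) x ≤ (-K) * (h ⬝ᵥ h) := fun x h => by
    have := h2 x h
    simp only
    linarith
  have key := fderiv_fderiv_le_of_secondDiff_le hneg h2' x u
  have e1 : fderiv ℝ (fun y => -f y) = fun y => -fderiv ℝ f y := by
    funext y; exact fderiv_fun_neg
  rw [e1] at key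
  have e2 : fderiv ℝ (fun y => -fderiv ℝ f y) x = -fderiv ℝ (fderiv ℝ f) x := fderiv_fun_neg
  rw [e2] at key
  simp only [neg_apply] at key
  linarith

/-- The second derivative of a `C²` function is symmetric. [folklore] -/
theorem fderiv_fderiv_symm {f : (Fin n → ℝ) → ℝ} (hf : ContDiff ℝ 2 f) (x u w : Fin n → ℝ) :
    fderiv ℝ (fderiv ℝ f) x u w = fderiv ℝ (fderiv ℝ f) x w u :=
  second_derivative_symmetric (f := f) (f' := fderiv ℝ f) (f'' := fderiv ℝ (fderiv ℝ f) x)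
    (fun y => (hf.differentiable (by norm_num) y).hasFDerivAt)
    (((hf.fderiv_right (m := 1) (by norm_num)).differentiable (by norm_num) x).hasFDerivAt) u w

/-- POLARISATION BOUND: a symmetric bilinear form with `|B(v,v)| ≤ K|v|²` satisfies
`|B(u,w)| ≤ (K/2)(|u|² + |w|²)`. [folklore] -/
theorem abs_bilin_le_of_diag {B : (Fin n → ℝ) →L[ℝ] (Fin n → ℝ) →L[ℝ] ℝ} {K : ℝ}
    (hsymm : ∀ u w, B u w = B w u) (hdiag : ∀ v, |B v v| ≤ K * (v ⬝ᵥ v)) (u w : Fin n → ℝ) :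
    |B u w| ≤ K / 2 * (u ⬝ᵥ u + w ⬝ᵥ w) := by
  have hpol : B u w = (B (u + w) (u + w) - B (u - w) (u - w)) / 4 := by
    have h1 : B (u + w) (u + w) = B u u + B u w + B w u + B w w := by
      simp only [map_add, add_apply]; ring
    have h2 : B (u - w) (u - w) = B u u - B u w - B w u + B w w := by
      simp only [map_sub, sub_apply]; ring
    rw [h1, h2, hsymm w u]; ring
  have hp := hdiag (u + w)
  have hm := hdiag (u - w)
  have hs : (u + w) ⬝ᵥ (u + w) + (u - w) ⬝ᵥ (u - w) = 2 * (u ⬝ᵥ u + w ⬝ᵥ w) := by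
    simp only [add_dotProduct, dotProduct_add, sub_dotProduct, dotProduct_sub, dotProduct_comm w u]
    ring
  rw [hpol, abs_div, abs_of_pos (by norm_num : (0:ℝ) < 4)]
  have := abs_sub (B (u + w) (u + w)) (B (u - w) (u - w))
  have hK : K / 2 * (u ⬝ᵥ u + w ⬝ᵥ w) = (K * ((u + w) ⬝ᵥ (u + w)) + K * ((u - w) ⬝ᵥ (u - w))) / 4 := by
    rw [← mul_add, hs]; ring
  rw [hK]
  exact div_le_div_of_nonneg_right (this.trans (add_le_add hp hm)) (by norm_num)

/-- `|x|² = x·x ≤ n·‖x‖²` for the sup norm on `ℝⁿ`. [folklore] -/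
theorem dotProduct_self_le_card_mul_norm_sq (x : Fin n → ℝ) : x ⬝ᵥ x ≤ (n : ℝ) * ‖x‖ ^ 2 := by
  calc x ⬝ᵥ x = ∑ i, x i ^ 2 := by simp [dotProduct, sq]
    _ ≤ ∑ _i : Fin n, ‖x‖ ^ 2 := Finset.sum_le_sum fun i _ => by
        have hi : |x i| ≤ ‖x‖ := by simpa [Real.norm_eq_abs] using norm_le_pi_norm x i
        rw [← sq_abs]; exact pow_le_pow_left₀ (abs_nonneg _) hi 2
    _ = (n : ℝ) * ‖x‖ ^ 2 := by simp

/-- Under the whitened sandwich `(1−δ)|h|² ≤ A(x+h)+A(x−h)−2A(x) ≤ (1+δ)|h|²` (`0 ≤ δ`) a `C²`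
potential has `|D²A(x)(u,w)| ≤ (1+δ)(|u|²+|w|²)/2`, in particular bounded second partials. [folklore] -/
theorem abs_fderiv_fderiv_le_of_sandwich {A : (Fin n → ℝ) → ℝ} (hA : ContDiff ℝ 2 A) {δ : ℝ}
    (hsw : ∀ x h : Fin n → ℝ, (1 - δ) * (h ⬝ᵥ h) ≤ A (x + h) + A (x - h) - 2 * A x ∧
      A (x + h) + A (x - h) - 2 * A x ≤ (1 + δ) * (h ⬝ᵥ h)) (x u w : Fin n → ℝ) :
    |fderiv ℝ (fderiv ℝ A) x u w| ≤ (1 + δ) / 2 * (u ⬝ᵥ u + w ⬝ᵥ w) := by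
  refine abs_bilin_le_of_diag (fderiv_fderiv_symm hA x) (fun v => ?_) u w
  have hup := fderiv_fderiv_le_of_secondDiff_le hA (fun y h => (hsw y h).2) x v
  have hlo := le_fderiv_fderiv_of_le_secondDiff hA (fun y h => (hsw y h).1) x v
  have hv : 0 ≤ v ⬝ᵥ v := by simpa using dotProduct_self_star_nonneg v
  rw [abs_le]
  constructor <;> nlinarith

/-- QUADRATIC GROWTH OF THE GRADIENT under the whitened sandwich: for a `C²` potential,
`|∂ᵥA(x)| ≤ ‖DA(0)‖·‖v‖ + (1+δ)(|x|² + |v|²)/2` (mean value inequality along `t ↦ t•x`). [folklore] -/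
theorem abs_fderiv_le_of_sandwich {A : (Fin n → ℝ) → ℝ} (hA : ContDiff ℝ 2 A) {δ : ℝ}
    (hsw : ∀ x h : Fin n → ℝ, (1 - δ) * (h ⬝ᵥ h) ≤ A (x + h) + A (x - h) - 2 * A x ∧
      A (x + h) + A (x - h) - 2 * A x ≤ (1 + δ) * (h ⬝ᵥ h)) (x v : Fin n → ℝ) :
    |fderiv ℝ A x v| ≤ ‖fderiv ℝ A 0‖ * ‖v‖ + (1 + δ) / 2 * (x ⬝ᵥ x + v ⬝ᵥ v) := by
  -- `ψ t := DA(t•x) v` has derivative `D²A(t•x)(x,v)`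
  set ψ : ℝ → ℝ := fun t => fderiv ℝ A (t • x) v with hψ
  have hd2 : ∀ y, HasFDerivAt (fderiv ℝ A) (fderiv ℝ (fderiv ℝ A) y) y := fun y =>
    (((hA.fderiv_right (m := 1) (by norm_num)).differentiable (by norm_num)) y).hasFDerivAt
  have hψ' : ∀ t, HasDerivAt ψ (fderiv ℝ (fderiv ℝ A) (t • x) x v) t := by
    intro t
    have h1 : HasDerivAt (fun s : ℝ => s • x) x t := by
      simpa using (hasDerivAt_id t).smul_const x
    have h2 : HasDerivAt (fun s : ℝ => fderiv ℝ A (s • x)) (fderiv ℝ (fderiv ℝ A) (t • x) x) t :=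
      (hd2 (t • x)).comp_hasDerivAt t h1
    have h3 := h2.clm_apply (hasDerivAt_const t v)
    simpa using h3
  have hbound : ∀ t ∈ Set.Ico (0:ℝ) 1, ‖fderiv ℝ (fderiv ℝ A) (t • x) x v‖ ≤
      (1 + δ) / 2 * (x ⬝ᵥ x + v ⬝ᵥ v) := fun t _ => by
    rw [Real.norm_eq_abs]
    exact abs_fderiv_fderiv_le_of_sandwich hA hsw (t • x) x v
  have hmvt := norm_image_sub_le_of_norm_deriv_le_segment_01' (f := ψ)
    (fun t _ => (hψ' t).hasDerivWithinAt) hbound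
  simp only [hψ, one_smul, zero_smul, Real.norm_eq_abs] at hmvt
  have h0 : |fderiv ℝ A 0 v| ≤ ‖fderiv ℝ A 0‖ * ‖v‖ := by
    rw [← Real.norm_eq_abs]; exact ContinuousLinearMap.le_opNorm _ _
  have := abs_sub_abs_le_abs_sub (fderiv ℝ A x v) (fderiv ℝ A 0 v)
  linarith


/-! ## Integrability against `e^{-A}` for polynomially bounded continuous weights -/

/-- `(1 + r)^k · e^{−(κ/2) r²} ≤ 16 (1 + 16/κ)^4` for `r ≥ 0`, `k ≤ 8`, `κ > 0`. [folklore] -/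
theorem pow_mul_exp_neg_le {κ : ℝ} (hκ : 0 < κ) {k : ℕ} (hk : k ≤ 8) {r : ℝ} (hr : 0 ≤ r) :
    (1 + r) ^ k * exp (-(κ / 2) * r ^ 2) ≤ 16 * (1 + 16 / κ) ^ 4 := by
  have h1 : (1 + r) ^ k ≤ (1 + r) ^ 8 := pow_le_pow_right₀ (by linarith) hk
  have h2 : (1 + r) ^ 8 ≤ 16 * (1 + r ^ 2) ^ 4 := by
    have h : (1 + r) ^ 2 ≤ 2 * (1 + r ^ 2) := by nlinarith [sq_nonneg (1 - r)]
    calc (1 + r) ^ 8 = ((1 + r) ^ 2) ^ 4 := by ring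
      _ ≤ (2 * (1 + r ^ 2)) ^ 4 := pow_le_pow_left₀ (sq_nonneg _) h 4
      _ = 16 * (1 + r ^ 2) ^ 4 := by ring
  have hκ4 : 0 < κ / 4 := by positivity
  have h3 := poly_exp_le 0 r hκ4
  simp only [zero_mul, zero_sub, ne_eq, OfNat.ofNat_ne_zero, not_false_eq_true, zero_pow,
    zero_div, add_zero, exp_zero, mul_one] at h3
  -- `h3 : (1 + r²)² · exp(−(κ/4) r²) ≤ (1 + 4/(κ/4))²·exp(−(κ/16) r²)`
  have h4 : (1 + r ^ 2) ^ 2 * exp (-(κ / 4) * r ^ 2) ≤ (1 + 16 / κ) ^ 2 := by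
    have he : exp (-(κ / 4 / 4) * r ^ 2) ≤ 1 := by
      rw [exp_le_one_iff]; nlinarith [sq_nonneg r]
    have hc : (1 + 4 / (κ / 4)) ^ 2 = (1 + 16 / κ) ^ 2 := by
      congr 1; field_simp; ring
    calc (1 + r ^ 2) ^ 2 * exp (-(κ / 4) * r ^ 2) ≤ (1 + 4 / (κ / 4)) ^ 2 * exp (-(κ / 4 / 4) * r ^ 2) := by
          have : -(κ / 4 * r ^ 2) = -(κ / 4) * r ^ 2 := by ring
          rw [this] at h3; exact h3
      _ ≤ (1 + 4 / (κ / 4)) ^ 2 * 1 := by gcongr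
      _ = (1 + 16 / κ) ^ 2 := by rw [mul_one, hc]
  have h5 : (1 + r ^ 2) ^ 4 * exp (-(κ / 2) * r ^ 2) ≤ (1 + 16 / κ) ^ 4 := by
    have he : exp (-(κ / 2) * r ^ 2) = exp (-(κ / 4) * r ^ 2) * exp (-(κ / 4) * r ^ 2) := by
      rw [← exp_add]; congr 1; ring
    have hsq : (1 + r ^ 2) ^ 4 * exp (-(κ / 2) * r ^ 2) = ((1 + r ^ 2) ^ 2 * exp (-(κ / 4) * r ^ 2)) ^ 2 := by
      rw [he]; ring
    rw [hsq, show (1 + 16 / κ) ^ 4 = ((1 + 16 / κ) ^ 2) ^ 2 by ring]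
    exact pow_le_pow_left₀ (by positivity) h4 2
  have hexp : 0 < exp (-(κ / 2) * r ^ 2) := exp_pos _
  calc (1 + r) ^ k * exp (-(κ / 2) * r ^ 2) ≤ (16 * (1 + r ^ 2) ^ 4) * exp (-(κ / 2) * r ^ 2) :=
        mul_le_mul_of_nonneg_right (h1.trans h2) hexp.le
    _ = 16 * ((1 + r ^ 2) ^ 4 * exp (-(κ / 2) * r ^ 2)) := by ring
    _ ≤ 16 * (1 + 16 / κ) ^ 4 := by gcongr

/-- GAUSSIAN DOMINATION, polynomial weights of degree `≤ 8`: if `A` is continuous with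
`−C(1+‖x‖) + κ‖x‖² ≤ A(x)` (`κ > 0`) and `w` is continuous with `|w(x)| ≤ D(1+‖x‖)^k`, `k ≤ 8`,
then `w·e^{−A}` is Lebesgue integrable on `ℝⁿ`. [folklore] -/
theorem integrable_mul_exp_neg_of_growth {A w : (Fin n → ℝ) → ℝ} (hA : Continuous A)
    (hw : Continuous w) {C κ D : ℝ} {k : ℕ} (hκ : 0 < κ) (hk : k ≤ 8)
    (hlb : ∀ x, -C * (1 + ‖x‖) + κ * ‖x‖ ^ 2 ≤ A x) (hwb : ∀ x, |w x| ≤ D * (1 + ‖x‖) ^ k) :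
    Integrable (fun x => w x * exp (-A x)) := by
  have hD : 0 ≤ D := by
    have := (abs_nonneg _).trans (hwb 0)
    simpa using this
  set A₁ : (Fin n → ℝ) → ℝ := fun x => A x - κ / 2 * ‖x‖ ^ 2 with hA₁
  set w₁ : (Fin n → ℝ) → ℝ := fun x => w x * exp (-(κ / 2) * ‖x‖ ^ 2) with hw₁
  have hA₁c : Continuous A₁ := hA.sub (continuous_const.mul (continuous_norm.pow 2))
  have hw₁c : Continuous w₁ :=
    hw.mul (continuous_exp.comp (continuous_const.mul (continuous_norm.pow 2)))
  have hlb₁ : ∀ x, -C * (1 + ‖x‖) + κ / 2 * ‖x‖ ^ 2 ≤ A₁ x := fun x => by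
    simp only [hA₁]; linarith [hlb x]
  have hwb₁ : ∀ x, |w₁ x| ≤ D * (16 * (1 + 16 / κ) ^ 4) * (1 + ‖x‖ ^ 2) ^ 2 := fun x => by
    have h1 := hwb x
    have h2 := pow_mul_exp_neg_le hκ hk (norm_nonneg x)
    have h3 : (1:ℝ) ≤ (1 + ‖x‖ ^ 2) ^ 2 := by nlinarith [sq_nonneg ‖x‖, sq_nonneg (‖x‖ ^ 2)]
    simp only [hw₁, abs_mul, abs_of_pos (exp_pos _)]
    calc |w x| * exp (-(κ / 2) * ‖x‖ ^ 2) ≤ D * (1 + ‖x‖) ^ k * exp (-(κ / 2) * ‖x‖ ^ 2) :=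
          mul_le_mul_of_nonneg_right h1 (exp_pos _).le
      _ = D * ((1 + ‖x‖) ^ k * exp (-(κ / 2) * ‖x‖ ^ 2)) := by ring
      _ ≤ D * (16 * (1 + 16 / κ) ^ 4) := mul_le_mul_of_nonneg_left h2 hD
      _ ≤ D * (16 * (1 + 16 / κ) ^ 4) * (1 + ‖x‖ ^ 2) ^ 2 := le_mul_of_one_le_right (by positivity) h3
  have key := integrable_mul_exp_neg_of_lower_bound hA₁c hw₁c (half_pos hκ) hlb₁ hwb₁
  refine key.congr (ae_of_all _ fun x => ?_)
  simp only [hw₁, hA₁]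
  rw [mul_assoc, ← exp_add]
  congr 2
  ring

/-- QUADRATIC LOWER BOUND from the whitened sandwich (`δ < 1`): `−C(1+‖x‖) + κ‖x‖² ≤ A(x)`
for some `C ≥ 0`, `κ > 0`. [folklore] -/
theorem exists_quadratic_lower_of_sandwich {A : (Fin n → ℝ) → ℝ} (hA : Continuous A) {δ : ℝ}
    (hδ1 : δ < 1)
    (hsw : ∀ x h : Fin n → ℝ, (1 - δ) * (h ⬝ᵥ h) ≤ A (x + h) + A (x - h) - 2 * A x ∧
      A (x + h) + A (x - h) - 2 * A x ≤ (1 + δ) * (h ⬝ᵥ h)) :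
    ∃ C κ : ℝ, 0 ≤ C ∧ 0 < κ ∧ ∀ x, -C * (1 + ‖x‖) + κ * ‖x‖ ^ 2 ≤ A x := by
  set c : ℝ := (1 - δ) / 2 with hc
  have hc0 : 0 < c := by rw [hc]; linarith
  set g : (Fin n → ℝ) → ℝ := fun x => A x - c * (x ⬝ᵥ x) with hgdef
  have hgcont : Continuous g := hA.sub (continuous_const.mul (continuous_id.dotProduct continuous_id))
  have hg2 : ∀ x h : Fin n → ℝ, 2 * g x ≤ g (x + h) + g (x - h) := by
    intro x h
    have h1 := (hsw x h).1
    have hq : (x + h) ⬝ᵥ (x + h) + (x - h) ⬝ᵥ (x - h) = 2 * (x ⬝ᵥ x) + 2 * (h ⬝ᵥ h) := by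
      simp only [add_dotProduct, sub_dotProduct, dotProduct_add, dotProduct_sub, dotProduct_comm h x]
      ring
    simp only [hgdef]
    have : c * ((x + h) ⬝ᵥ (x + h)) + c * ((x - h) ⬝ᵥ (x - h)) = 2 * (c * (x ⬝ᵥ x)) + (1 - δ) * (h ⬝ᵥ h) := by
      rw [← mul_add, hq, hc]; ring
    linarith
  obtain ⟨C, hC0, hClb⟩ := exists_linear_lower_of_secondDiff_nonneg hgcont hg2
  obtain ⟨lam, hlam, hlamle⟩ := exists_pos_mul_norm_sq_le (Matrix.PosDef.one (n := Fin n) (R := ℝ))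
  refine ⟨C, c * lam, hC0, mul_pos hc0 hlam, fun x => ?_⟩
  have h1 := hClb x
  have h2 : lam * ‖x‖ ^ 2 ≤ x ⬝ᵥ x := by simpa using hlamle x
  have h3 : A x = g x + c * (x ⬝ᵥ x) := by simp [hgdef]
  rw [h3]
  nlinarith [mul_le_mul_of_nonneg_left h2 hc0.le]

/-! ## Smooth potentials: continuity and growth of derivatives -/

/-- `x ↦ ∂ᵥA(x)` is continuous for `A ∈ C²`. [folklore] -/
theorem continuous_fderiv_apply_of_contDiff {A : (Fin n → ℝ) → ℝ} (hA : ContDiff ℝ 2 A)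
    (v : Fin n → ℝ) : Continuous fun x => fderiv ℝ A x v :=
  (hA.continuous_fderiv (by norm_num)).clm_apply continuous_const

/-- `x ↦ D²A(x)(u(x), w(x))` is continuous for `A ∈ C²` and continuous `u, w`. [folklore] -/
theorem continuous_fderiv_fderiv_apply_of_contDiff {A : (Fin n → ℝ) → ℝ} (hA : ContDiff ℝ 2 A)
    {u w : (Fin n → ℝ) → (Fin n → ℝ)} (hu : Continuous u) (hw : Continuous w) :
    Continuous fun x => fderiv ℝ (fderiv ℝ A) x (u x) (w x) :=
  (((hA.fderiv_right (m := 1) (by norm_num)).continuous_fderiv (by norm_num)).clm_apply hu).clm_apply hw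

/-- GRADIENT GROWTH in sup-norm currency: `|∂ᵥA(x)| ≤ K(1+‖x‖)²` for some `K ≥ 0`
(fixed direction `v`). [folklore] -/
theorem exists_abs_fderiv_le_of_sandwich {A : (Fin n → ℝ) → ℝ} (hA : ContDiff ℝ 2 A) {δ : ℝ}
    (hδ : 0 ≤ δ)
    (hsw : ∀ x h : Fin n → ℝ, (1 - δ) * (h ⬝ᵥ h) ≤ A (x + h) + A (x - h) - 2 * A x ∧
      A (x + h) + A (x - h) - 2 * A x ≤ (1 + δ) * (h ⬝ᵥ h)) (v : Fin n → ℝ) :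
    ∃ K : ℝ, 0 ≤ K ∧ ∀ x, |fderiv ℝ A x v| ≤ K * (1 + ‖x‖) ^ 2 := by
  refine ⟨‖fderiv ℝ A 0‖ * ‖v‖ + (1 + δ) / 2 * ((n : ℝ) + (n : ℝ) * ‖v‖ ^ 2), by positivity,
    fun x => ?_⟩
  have h1 := abs_fderiv_le_of_sandwich hA hsw x v
  have hx := dotProduct_self_le_card_mul_norm_sq x
  have hv := dotProduct_self_le_card_mul_norm_sq v
  have hr := norm_nonneg x
  have h2 : (n : ℝ) * ‖x‖ ^ 2 ≤ (n : ℝ) * (1 + ‖x‖) ^ 2 := by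
    gcongr; nlinarith
  have h3 : (1 : ℝ) ≤ (1 + ‖x‖) ^ 2 := by nlinarith
  have hn : (0 : ℝ) ≤ n := Nat.cast_nonneg n
  have ha : ‖fderiv ℝ A 0‖ * ‖v‖ ≤ ‖fderiv ℝ A 0‖ * ‖v‖ * (1 + ‖x‖) ^ 2 :=
    le_mul_of_one_le_right (by positivity) h3
  have hb : x ⬝ᵥ x ≤ (n : ℝ) * (1 + ‖x‖) ^ 2 := hx.trans h2
  have hc : v ⬝ᵥ v ≤ (n : ℝ) * ‖v‖ ^ 2 * (1 + ‖x‖) ^ 2 :=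
    hv.trans (le_mul_of_one_le_right (by positivity) h3)
  have hd : 0 ≤ (1 + δ) / 2 := by positivity
  calc |fderiv ℝ A x v| ≤ ‖fderiv ℝ A 0‖ * ‖v‖ + (1 + δ) / 2 * (x ⬝ᵥ x + v ⬝ᵥ v) := h1
    _ ≤ ‖fderiv ℝ A 0‖ * ‖v‖ * (1 + ‖x‖) ^ 2 +
        (1 + δ) / 2 * ((n : ℝ) * (1 + ‖x‖) ^ 2 + (n : ℝ) * ‖v‖ ^ 2 * (1 + ‖x‖) ^ 2) :=
        add_le_add ha (mul_le_mul_of_nonneg_left (add_le_add hb hc) hd)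
    _ = (‖fderiv ℝ A 0‖ * ‖v‖ + (1 + δ) / 2 * ((n : ℝ) + (n : ℝ) * ‖v‖ ^ 2)) * (1 + ‖x‖) ^ 2 := by
        ring

/-- SECOND PARTIALS ARE BOUNDED: `|D²A(x)(u,w)| ≤ (1+δ)·n·(‖u‖²+‖w‖²)/2`. [folklore] -/
theorem abs_fderiv_fderiv_le_norm {A : (Fin n → ℝ) → ℝ} (hA : ContDiff ℝ 2 A) {δ : ℝ}
    (hsw : ∀ x h : Fin n → ℝ, (1 - δ) * (h ⬝ᵥ h) ≤ A (x + h) + A (x - h) - 2 * A x ∧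
      A (x + h) + A (x - h) - 2 * A x ≤ (1 + δ) * (h ⬝ᵥ h)) (hδ : 0 ≤ δ) (x u w : Fin n → ℝ) :
    |fderiv ℝ (fderiv ℝ A) x u w| ≤ (1 + δ) / 2 * ((n : ℝ) * ‖u‖ ^ 2 + (n : ℝ) * ‖w‖ ^ 2) := by
  have h := abs_fderiv_fderiv_le_of_sandwich hA hsw x u w
  have hu := dotProduct_self_le_card_mul_norm_sq u
  have hw := dotProduct_self_le_card_mul_norm_sq w
  have : (1 + δ) / 2 * (u ⬝ᵥ u + w ⬝ᵥ w) ≤ (1 + δ) / 2 * ((n : ℝ) * ‖u‖ ^ 2 + (n : ℝ) * ‖w‖ ^ 2) :=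
    mul_le_mul_of_nonneg_left (add_le_add hu hw) (by positivity)
  exact h.trans this

end Summit.QuantumFields.YangMills.Theorems.SandwichVariancePinching

end
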